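import Literature.AlgebraicGeometry.Modules.QuasicoherentCoproducts
import Mathlib.CategoryTheory.Limits.Constructions.LimitsOfProductsAndEqualizers
import HarnessLib

/-!
# Colimits of quasi-coherent `𝒪_X`-modules are quasi-coherent (Stacks 01LA (2))

Layer `Literature/AlgebraicGeometry/Modules` (0 definitions, 0 named facts, no instances, no notation). The Stacks Project,
Tag 01LA (2): "Let `X` be a scheme. … Any colimit of quasi-coherent sheaves (in `Mod(𝒪_X)`) is quasi-coherent"; Görtz–Wedhorn I
Cor. 7.19. Proof as printed ("a colimit is a coequalizer of a pair of maps between direct sums", Stacks 002P): coproducts of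
quasi-coherent modules are quasi-coherent (`Modules/QuasicoherentCoproducts.isQuasicoherent_sigmaObj`), a coequalizer of
`s, t : M ⇉ N` is the cokernel of `s - t` (Mathlib `Preadditive.isColimitCoforkOfCokernelCofork`), cokernels of
quasi-coherent modules are quasi-coherent (`Modules/QuasicoherentAbelian.isQuasicoherent_cokernel`), and Mathlib's
`colimitCoconeOfCoequalizerAndCoproduct` presents `colim F` as such a coequalizer.

* `isQuasicoherent_coequalizer` — coequalizers;
* **`isQuasicoherent_colimit`** — `colimit F` is quasi-coherent for every small diagram `F : J ⥤ Mod(𝒪_X)` (`J` a small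
  category in the universe of `X`) of quasi-coherent modules;
* **`IsAffineLocalizing.colimit`** — the same for the tree's predicate.

Everything is proved; no named fact. Library only (cell `pub-hodge-ring2`, count-neutral; proves nothing about any crux, route
or conjecture).

## References

* The Stacks Project, Tag 01LA (2) (colimits of quasi-coherent modules), Tag 002P (colimits from coproducts and
  coequalizers). [StacksProject]
* U. Görtz, T. Wedhorn, *Algebraic Geometry I*, 2nd ed. (2020), Cor. 7.19. [GortzWedhorn2020]
* R. Hartshorne, *Algebraic Geometry*, GTM 52 (1977), II Prop. 5.7. [Hartshorne1977]
-/

noncomputable section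

-- `TopCat.Presheaf`/`Scheme.Modules` are not reducible (as in Mathlib's `AlgebraicGeometry/Modules/Sheaf.lean`).
set_option backward.isDefEq.respectTransparency false

open CategoryTheory CategoryTheory.Limits AlgebraicGeometry
open SheafOfModules

universe u

namespace Literature.AlgebraicGeometry.Modules

variable {X : Scheme.{u}}

/-- **A coequalizer of two morphisms of quasi-coherent modules is quasi-coherent**: it is the cokernel of their
difference (Mathlib `Preadditive.isColimitCoforkOfCokernelCofork`), and cokernels of quasi-coherent modules are quasi-coherent.
[cite: StacksProject, Tag 01LA] [cite: GortzWedhorn2020, Cor. 7.19] -/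
theorem isQuasicoherent_coequalizer {M N : X.Modules} (s t : M ⟶ N) [M.IsQuasicoherent] [N.IsQuasicoherent] :
    (coequalizer s t).IsQuasicoherent := by
  haveI := isQuasicoherent_cokernel (s - t)
  -- `cokernel (s - t)` is a coequalizer of `s`, `t`
  let hc : IsColimit (Preadditive.coforkOfCokernelCofork (CokernelCofork.ofπ (cokernel.π (s - t)) (cokernel.condition _))) :=
    Preadditive.isColimitCoforkOfCokernelCofork (cokernelIsCokernel (s - t))
  let e : cokernel (s - t) ≅ coequalizer s t := hc.coconePointUniqueUpToIso (colimit.isColimit (parallelPair s t))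
  exact (SheafOfModules.isQuasicoherent X.ringCatSheaf).prop_of_iso e inferInstance

/-- **A colimit of quasi-coherent `𝒪_X`-modules is quasi-coherent** (Stacks 01LA (2)): `colim F` is the coequalizer of two
morphisms between coproducts of the (quasi-coherent) values of `F` (Mathlib `colimitCoconeOfCoequalizerAndCoproduct`,
Stacks 002P), and coproducts / coequalizers of quasi-coherent modules are quasi-coherent.
[cite: StacksProject, Tag 01LA] [cite: StacksProject, Tag 002P] [cite: GortzWedhorn2020, Cor. 7.19] -/
theorem isQuasicoherent_colimit {J : Type u} [SmallCategory J] (F : J ⥤ X.Modules) [∀ j, (F.obj j).IsQuasicoherent] :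
    (colimit F).IsQuasicoherent := by
  haveI : ((colimit.cocone (Discrete.functor F.obj)).pt).IsQuasicoherent := isQuasicoherent_sigmaObj _
  haveI : ((colimit.cocone (Discrete.functor fun f : (Σ p : J × J, p.1 ⟶ p.2) => F.obj f.1.1)).pt).IsQuasicoherent :=
    isQuasicoherent_sigmaObj _
  have h : ((colimitCoconeOfCoequalizerAndCoproduct F).cocone.pt).IsQuasicoherent := isQuasicoherent_coequalizer _ _
  exact (SheafOfModules.isQuasicoherent X.ringCatSheaf).prop_of_iso
    (colimit.isoColimitCocone (colimitCoconeOfCoequalizerAndCoproduct F)).symm h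

/-- **Stacks 01LA (2) for the tree's predicate**: a colimit of affine-localizing modules is affine-localizing.
[cite: StacksProject, Tag 01LA] [cite: Hartshorne1977, II Prop. 5.7] -/
theorem IsAffineLocalizing.colimit {J : Type u} [SmallCategory J] (F : J ⥤ X.Modules)
    (hF : ∀ j, IsAffineLocalizing (F.obj j)) : IsAffineLocalizing (Limits.colimit F) := by
  haveI : ∀ j, (F.obj j).IsQuasicoherent := fun j => isQuasicoherent_of_isAffineLocalizing (hF j)
  haveI := isQuasicoherent_colimit F
  exact IsAffineLocalizing.of_isQuasicoherent _

end Literature.AlgebraicGeometry.Modules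

end
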